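import Literature.AnabelianGeometry.AbsoluteAnabelian.AbsTopIII.BiAnabelianCompatibility
import Literature.AnabelianGeometry.AbsoluteAnabelian.AbsTopIII.BiAnabelianStarOverE
import Literature.AnabelianGeometry.AbsoluteAnabelian.AbsTopIII.FrobeniusPictureMLFCompatibilityTransport
import Literature.AnabelianGeometry.AbsoluteAnabelian.AbsTopIII.BiAnabelianNexusProofs
import Literature.AnabelianGeometry.AbsoluteAnabelian.DiagramShiftInvarianceLifts

/-!
# [AbsTopIII] Corollary 3.7 (ii) last sentence and (v) final sentence (cores part) — PROVED for every setting

S. Mochizuki, *Topics in Absolute Anabelian Geometry III*, Cor. 3.7 p. 88 l. 19–21 ((ii), last sentence: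
"`𝒟* = 𝒟*_{≤4}` admits a natural structure of core on `𝒟*_{≤3}` in a fashion compatible with the core structure of
`𝒟†_{≤4}` on `𝒟†_{≤3}`") and l. 52–54 ((v), final sentence, the cores part); Def. 3.5 (ii), (v) pp. 75–76;
proof p. 88: "entirely similar to the proofs of the corresponding assertions of Corollary 3.6" (kurims
manuscript `paper:url-5493eb38cbb7`; bib key `MochizukiAbsTopIII2015`).  Seat abc-iut-L4-t5 (gen 5); PROOF
companion of `BiAnabelianCompatibility.lean` (the literal statements), on the pattern of the Cor. 3.6 files
`FrobeniusPictureMLFCompatibilityTransport` / `…CoresCompatible` (abc-iut-L4-t5) and `…ShiftCores`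
(abc-iut-w6-d023): abc-iut-L4-t9's augmentation `starAug`/`starAugIso` ("the Galois group is undisturbed") IS
structure functors over `𝔈` (`overE`); the universal family `K₀ = coresFamily` over `𝔈` through the vertex `𝔈`
(`DiagramUniversalFamilies`) pulls back along `embStarCore` / `embGalCore` to core structures on `(𝒟*, 𝔈)` and
`(𝒟†_{≤4}, 𝔈)` (`starCoreCompatStmt_holds`), and is invariant under abc-iut-L4-t12's nexus self-equivalences
`shiftEquiv m` (`compatibleWith_shiftEquiv_coresFamily`, via abc-iut-w6-d023's quiver-generic
`DiagramShiftInvariance*`).  `overE` / `coresFamily` live in `BiAnabelianStarOverE.lean`; here: pullbacks and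
invariance, every statement proved; no `Prop` fact; refereed pre-IUT material; nothing here bears on
[IUTchIII] Cor. 3.12.
-/

namespace Literature.AnabelianGeometry.AbsoluteAnabelian.AbsTopIII

open CategoryTheory Quiver
open Literature.AnabelianGeometry.AbsoluteAnabelian.DiagramOfCategories

universe u

namespace BiAnabelianSetting

variable {X E N : Type u} [Category.{u} X] [Category.{u} E] [Category.{u} N]
  (𝔖 : BiAnabelianSetting X E N)

/-! ### The two core presentations ARE the pulled-back diagrams `emb^*𝒟*` -/

/-- `𝒟*_{≤3} ∪ {𝔈}` IS `embStarCore^*𝒟*`. [cite: MochizukiAbsTopIII2015, Cor 3.7 (ii) p.88] -/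
theorem starCoreDiagram_eq_comapAlong :
    (𝔖.starLe 3).extend 𝔖.starGalCoreExt = 𝔖.starDiagram.comapAlong embStarCore :=
  𝔖.starDiagram.eq_comapAlong embStarCore (fun a => by rcases a with _ | _ <;> rfl)
    (fun a => by rcases a with _ | _ <;> exact HEq.rfl)
    (fun e => by
      rename_i a b
      revert e
      rcases a with ⟨_ | _ | _ | _ | _, _⟩ | _ <;> rcases b with _ | _ <;> intro e <;>
        first | exact (PEmpty.elim e) | exact HEq.rfl)

/-- `𝒟†_{≤3} ∪ {𝔈}` IS `embGalCore^*𝒟*`. [cite: MochizukiAbsTopIII2015, Cor 3.7 (i) p.87] -/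
theorem galCoreDiagram_eq_comapAlong :
    (𝔖.daggerLe 3).extend 𝔖.galCoreExt = 𝔖.starDiagram.comapAlong embGalCore :=
  𝔖.starDiagram.eq_comapAlong embGalCore (fun a => by rcases a with _ | _ <;> rfl)
    (fun a => by rcases a with _ | _ <;> exact HEq.rfl)
    (fun e => by
      rename_i a b
      revert e
      rcases a with ⟨_ | _ | _ | _ | _, _⟩ | _ <;> rcases b with _ | _ <;> intro e <;>
        first | exact (PEmpty.elim e) | exact HEq.rfl)

/-- The pullback of a family `K` on `𝒟*` to `𝒟*_{≤3} ∪ {𝔈}`. [cite: MochizukiAbsTopIII2015, Cor 3.7 (ii) p.88] -/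
noncomputable def pullStarCore (K : 𝔖.starDiagram.HomotopyFamily) :
    ((𝔖.starLe 3).extend 𝔖.starGalCoreExt).HomotopyFamily :=
  𝔖.starCoreDiagram_eq_comapAlong.symm ▸ K.comap embStarCore

/-- Its boundary set. [cite: MochizukiAbsTopIII2015, Cor 3.7 (ii) p.88] -/
theorem pullStarCore_E_iff (K : 𝔖.starDiagram.HomotopyFamily) {a b : starGalCoreShape.{u}.Vertex}
    (p q : Path a b) : (𝔖.pullStarCore K).E p q ↔ K.E (embStarCore.mapPath p) (embStarCore.mapPath q) :=
  HomotopyFamily.cast_E_iff _ _ p q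

/-- Its compatibility with `K`. [cite: MochizukiAbsTopIII2015, Cor 3.7 (ii) p.88] -/
theorem pullStarCore_compatibleAlong (K : 𝔖.starDiagram.HomotopyFamily) :
    (𝔖.pullStarCore K).CompatibleAlong embStarCore K :=
  fun _ _ p q hE => K.cast_comap_compatible embStarCore 𝔖.starCoreDiagram_eq_comapAlong.symm p q hE

/-- The pullback of a family `K` on `𝒟*` to `𝒟†_{≤3} ∪ {𝔈}`. [cite: MochizukiAbsTopIII2015, Cor 3.7 (i) p.87] -/
noncomputable def pullGalCore (K : 𝔖.starDiagram.HomotopyFamily) :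
    ((𝔖.daggerLe 3).extend 𝔖.galCoreExt).HomotopyFamily :=
  𝔖.galCoreDiagram_eq_comapAlong.symm ▸ K.comap embGalCore

/-- Its boundary set. [cite: MochizukiAbsTopIII2015, Cor 3.7 (i) p.87] -/
theorem pullGalCore_E_iff (K : 𝔖.starDiagram.HomotopyFamily) {a b : galCoreShape.{u}.Vertex}
    (p q : Path a b) : (𝔖.pullGalCore K).E p q ↔ K.E (embGalCore.mapPath p) (embGalCore.mapPath q) :=
  HomotopyFamily.cast_E_iff _ _ p q

/-- Its compatibility with `K`. [cite: MochizukiAbsTopIII2015, Cor 3.7 (i) p.87] -/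
theorem pullGalCore_compatibleAlong (K : 𝔖.starDiagram.HomotopyFamily) :
    (𝔖.pullGalCore K).CompatibleAlong embGalCore K :=
  fun _ _ p q hE => K.cast_comap_compatible embGalCore 𝔖.galCoreDiagram_eq_comapAlong.symm p q hE

/-- The observation vertex of `𝒟*_{≤3} ∪ {𝔈}` has no outgoing edges. [cite: MochizukiAbsTopIII2015, Cor 3.7 (ii) p.88] -/
theorem isEmpty_hom_starCoreObs (b : starGalCoreShape.{u}.Vertex) : IsEmpty (starGalCoreShape.{u}.obs ⟶ b) := by
  rcases b with _ | _ <;> exact ⟨fun e => PEmpty.elim e⟩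

/-- The observation vertex of `𝒟†_{≤3} ∪ {𝔈}` has no outgoing edges. [cite: MochizukiAbsTopIII2015, Cor 3.7 (i) p.87] -/
theorem isEmpty_hom_galCoreObs (b : galCoreShape.{u}.Vertex) : IsEmpty (galCoreShape.{u}.obs ⟶ b) := by
  rcases b with _ | _ <;> exact ⟨fun e => PEmpty.elim e⟩

/-! ### Cor 3.7 (ii), last sentence, DISCHARGED -/

/-- The universal family `K₀` on `𝒟*` over `𝔈` through the vertex `𝔈` contains (Def. 3.5 (ii), along the
embeddings) a core structure on `(𝒟*, 𝔈)` AND a core structure on `(𝒟†_{≤4}, 𝔈)` — its pulled-back pairs ending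
at `𝔈` are ALL co-verticial pairs into `𝔈` ("the Galois group is undisturbed").
[cite: MochizukiAbsTopIII2015, Cor 3.7 (ii) p.88] -/
theorem coresFamily_realises_cores :
    (∃ H hH, (𝔖.starGalCoreObs H hH).IsCore ∧ H.CompatibleAlong embStarCore 𝔖.coresFamily) ∧
    (∃ H hH, (𝔖.galCoreObs H hH).IsCore ∧ H.CompatibleAlong embGalCore 𝔖.coresFamily) := by
  refine ⟨⟨(𝔖.pullStarCore 𝔖.coresFamily).endingAt _ isEmpty_hom_starCoreObs, fun _ _ _ _ h => h.1,
      ⟨fun _ p q => ⟨rfl, (𝔖.pullStarCore_E_iff _ p q).mpr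
        (univE_of_mem galoisVertex rfl (embStarCore.mapPath p) (embStarCore.mapPath q))⟩,
        starGalCore_reaches⟩,
      HomotopyFamily.endingAt_compatibleAlong _ _ _ (𝔖.pullStarCore_compatibleAlong _) _ _⟩,
    ⟨(𝔖.pullGalCore 𝔖.coresFamily).endingAt _ isEmpty_hom_galCoreObs, fun _ _ _ _ h => h.1,
      ⟨fun _ p q => ⟨rfl, (𝔖.pullGalCore_E_iff _ p q).mpr
        (univE_of_mem galoisVertex rfl (embGalCore.mapPath p) (embGalCore.mapPath q))⟩,
        galCore_reaches⟩,
      HomotopyFamily.endingAt_compatibleAlong _ _ _ (𝔖.pullGalCore_compatibleAlong _) _ _⟩⟩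

/-- **[AbsTopIII] Cor. 3.7 (ii), last sentence — the literal compatibility — PROVED for every setting** (the
universal family `K₀` over `𝔈` witnesses it). [cite: MochizukiAbsTopIII2015, Cor 3.7 (ii) p.88] -/
theorem starCoreCompatStmt_holds : 𝔖.StarCoreCompatStmt := ⟨𝔖.coresFamily, 𝔖.coresFamily_realises_cores⟩

/-! ### Cor 3.7 (v), final sentence — the CORES part, unconditionally: `Φ_m` is compatible with `K₀` -/

/-- **`𝒟*` is invariant under the translation of its first row** (`(shift m)^*𝒟* = 𝒟*`).
[cite: MochizukiAbsTopIII2015, Cor 3.7 (v) p.88] -/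
theorem comapAlong_shift (m : ℤ) : 𝔖.starDiagram.comapAlong (Cor37Vertex.shift.{u, u} m) = 𝔖.starDiagram :=
  DiagramOfCategories.ext' (fun a => by cases a <;> rfl) (fun a => by cases a <;> exact HEq.rfl)
    (fun {a b} e => by cases e <;> exact HEq.rfl)

/-- The structure functors over `𝔈` are invariant under the shift.
[cite: MochizukiAbsTopIII2015, Cor 3.7 (v) p.88] -/
theorem overE_comapAlong_shift_heq (m : ℤ) :
    HEq (𝔖.overE.comapAlong (Cor37Vertex.shift.{u, u} m)) 𝔖.overE :=
  OverData.heq_of_eq (𝔖.comapAlong_shift m) (fun a => by cases a <;> exact HEq.rfl)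
    (fun {a b} e => by cases e <;> exact HEq.rfl)

/-- The core vertex `𝔈` is fixed by the shift. [cite: MochizukiAbsTopIII2015, Cor 3.7 (v) p.88] -/
theorem galoisVertex_shift (m : ℤ) : ∀ w : Cor37Vertex, galoisVertex w → galoisVertex (Cor37Vertex.shiftObj m w) := by
  rintro w rfl; rfl

/-- The full-faithfulness witness at `𝔈` does not see the shift. [cite: MochizukiAbsTopIII2015, Cor 3.7 (v) p.88] -/
theorem galoisVertex_fullyFaithful_shift_heq (m : ℤ) (w : Cor37Vertex) (hw : galoisVertex w) :
    HEq (𝔖.galoisVertex_fullyFaithful (Cor37Vertex.shiftObj m w) (galoisVertex_shift m w hw))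
      (𝔖.galoisVertex_fullyFaithful w hw) := by
  cases hw; exact HEq.rfl

/-- The boundary set of `K₀` is stable under the shift. [cite: MochizukiAbsTopIII2015, Cor 3.7 (v) p.88] -/
theorem coresFamily_E_shift (m : ℤ) {a b : Cor37Vertex} {P Q : Path a b} (h : 𝔖.coresFamily.E P Q) :
    𝔖.coresFamily.E ((Cor37Vertex.shift.{u, u} m).mapPath P) ((Cor37Vertex.shift.{u, u} m).mapPath Q) :=
  univE_mapPath galoisVertex (Cor37Vertex.shift.{u, u} m) (galoisVertex_shift m) h

/-- `Φ_Γ⃗` induces a bijection between the boundary sets of `K₀`. [cite: MochizukiAbsTopIII2015, Cor 3.7 (v) p.88] -/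
theorem coresFamily_E_shift_iff (m : ℤ) {a b : Cor37Vertex} (P Q : Path a b) :
    𝔖.coresFamily.E P Q ↔
      𝔖.coresFamily.E ((Cor37Vertex.shift.{u, u} m).mapPath P) ((Cor37Vertex.shift.{u, u} m).mapPath Q) :=
  HomotopyFamily.E_mapPath_iff_of_inverse (Cor37Vertex.shift_comp_neg m) 𝔖.coresFamily.E
    (fun _ _ _ _ h => 𝔖.coresFamily_E_shift m h) (fun _ _ _ _ h => 𝔖.coresFamily_E_shift (-m) h) P Q

/-- The homotopies of `K₀` are invariant under the shift. [cite: MochizukiAbsTopIII2015, Cor 3.7 (v) p.88] -/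
theorem coresFamily_η_shift_heq (m : ℤ) {a b : Cor37Vertex} {P Q : Path a b} (h : 𝔖.coresFamily.E P Q)
    (h' : 𝔖.coresFamily.E ((Cor37Vertex.shift.{u, u} m).mapPath P) ((Cor37Vertex.shift.{u, u} m).mapPath Q)) :
    HEq (𝔖.coresFamily.η h') (𝔖.coresFamily.η h) :=
  univFamily_η_mapPath_heq 𝔖.overE galoisVertex 𝔖.galoisVertex_fullyFaithful (Cor37Vertex.shift.{u, u} m)
    (𝔖.comapAlong_shift m) (𝔖.overE_comapAlong_shift_heq m) (galoisVertex_shift m)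
    (𝔖.galoisVertex_fullyFaithful_shift_heq m) h h'

/-- **[AbsTopIII] Cor. 3.7 (v), final sentence, CORES PART — PROVED for every setting**: the nexus
self-equivalence `Φ_m` (abc-iut-L4-t12's `shiftEquiv`) is compatible, in the sense of Def. 3.5 (v), with the
universal family `K₀` over `𝔈` — the family that constitutes the two `𝔈`-cores of (i), (ii)
(`starCoreCompatStmt_holds`). [cite: MochizukiAbsTopIII2015, Cor 3.7 (v) p.88] -/
theorem compatibleWith_shiftEquiv_coresFamily (m : ℤ) :
    Nonempty ((𝔖.shiftEquiv m).hom.CompatibleWith 𝔖.coresFamily 𝔖.coresFamily) :=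
  OneMorphism.nonempty_compatibleWith_of_invariant (𝔖.shiftMor m) (𝔖.comapAlong_shift m)
    (𝔖.shiftApp_heq_id m) (𝔖.shiftMor_iso_app m)
    (fun _ _ p' => Prefunctor.exists_mapPath_eq_of_inverse (Cor37Vertex.shift_comp_neg m)
      (Cor37Vertex.shift_neg_comp m) p')
    𝔖.coresFamily 𝔖.coresFamily (fun _ _ P Q => 𝔖.coresFamily_E_shift_iff m P Q)
    (fun _ _ _ _ h => 𝔖.coresFamily_η_shift_heq m h _)

end BiAnabelianSetting

end Literature.AnabelianGeometry.AbsoluteAnabelian.AbsTopIII
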